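import Literature.AlgebraicGeometry.Resolution.WeightedCentreInseparableSplit
import HarnessLib

/-!
# `max W(u² + uv³ + v⁴) = (2, 5)` in characteristic `2`, and the subtracted fourth power `v⁴`

[ATW24] Abramovich–Temkin–Włodarczyk, *Functorial embedded resolution via weighted blowings up*,
Algebra & Number Theory 18 (2024), §5.1 (p. 1575), Thm. 5.3.1 (2)–(3) (p. 1578), Lemma 5.2.6 (p. 1576).
[CJS20] Cossart–Jannsen–Saito, *Desingularization: Invariants and Strategy*, LNM 2270 (2020), Def. 8.1 (3) /
Def. 8.2 (1) (pp. 117–118: `δ(f; u; y)`), Def. 8.8 / Thm. 8.16 (pp. 119–121: vertex preparation `y ↦ y + λ u^A`).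
[HP19] Hauser–Perlega, J. Algebraic Geom. 28 (2019), §2 (cleaning of `p^e`-th powers; the residual order).
[Hau10] Hauser, Bull. AMS 47 (2010), §C–§D (pp. 9–12: failure of maximal contact in characteristic `p`).

## What is proved (the polynomial `W(f)` model of `WeightedCentreInvariantSet`; `char k = 2`; `x = X 0 = v`, `y = X 1 = u`)

Let `h := y² + x³y + x⁴ = u² + uv³ + v⁴`.
* `addPolyShear_symm_ecShape` — after `y ↦ y − x²` (the square root of the `δ`-face initial form `y² + x⁴ =
  (y + x²)²`), `h = y² + x³y − x⁵` (Frobenius `(y − x²)² = y² − x⁴`).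
* `isCentreFor_ecShape`, `ecShape_mem_admissibleInvariants` — the centre `(y − x², x; 1/2, 1/5)` is admissible:
  **`(2, 5) ∈ W(h)`**.
* `hironakaDelta_ecShape` — `δ(y² + x³y − x⁵; x; y) = 5/2` (vertices `x³y ↦ 3`, `x⁵ ↦ 5/2`), `isDeltaPrepared_ecShape`
  (vacuous: `5/2 ∉ ℤ`), `monomialOrd_ecShape` (`ord = 2`), `homogeneousComponent_ecShape` (`in_2 = y²`, `τ = 1`).
* `not_lt_of_mem_admissibleInvariants_ecShape`, **`isMaxInv_ecShape` — `max W(u² + uv³ + v⁴) = (2, 5)`** (vertex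
  theorem `succ_card_le_countP_exps_of_isDeltaPrepared` for `S = {y}`, `ν = 2`, transported by
  `admissibleInvariants_map_eq`).
* `ecShape_sub_pow_mem_admissibleInvariants` — **`(2, 6) ∈ W(h − v⁴) = W(u² + uv³)`** (centre `(u, v; 1/2, 1/6)`),
  and `ecShape_counterexample` — the conjunction: the maximum `(2, 5)` of `W(h)` has no entry with numerator
  divisible by `q = 4`, yet subtracting the `4`-th power `v⁴ = (v)⁴` IMPROVES the invariant to `(2, 6) > (2, 5)`.

This types the observatory's refutation (engine 1, gen 24, Prop. K / C161) of its own data law C146 ("if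
`C_q(h) ≠ W(h)` then some entry of `max W(h)` has numerator divisible by `q`", 235/235 certified split rows):
false at `p = 2`, `q = 4`.  Value type: typed theorems in the polynomial `W(f)` model — not a resolution theorem.
-/

noncomputable section

open MvPolynomial

namespace Literature.AlgebraicGeometry.Resolution

namespace WeightedBlowup

variable {k : Type*} [Field k]

/-! ## §1 Plumbing (two variables) -/

/-- The inverse shear on the sheared variable (plumbing). [folklore] -/
private theorem addPolyShear_symm_X_self₁₉ {σ : Type*} [DecidableEq σ] (a : σ) (q : MvPolynomial σ k) :
    (addPolyShear a q).symm (X a) = X a - killVar a q := by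
  simp [addPolyShear, sub_eq_add_neg]

/-- The inverse shear fixes the other variables (plumbing). [folklore] -/
private theorem addPolyShear_symm_X_of_ne₁₉ {σ : Type*} [DecidableEq σ] (a : σ) (q : MvPolynomial σ k) {x : σ}
    (hx : x ≠ a) : (addPolyShear a q).symm (X x) = X x := by
  simp [addPolyShear, hx]

/-- `ν_w(x^i y^j) = i·w₀ + j·w₁` (plumbing). [cite: AbramovichTemkinWlodarczyk2024, Rem. 2.4.2 (p. 1568)] -/
private theorem monomialOrd_X_pow_mul_X_pow₁₉ (w : Fin 2 → ℕ) (i j : ℕ) :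
    monomialOrd w (X 0 ^ i * X 1 ^ j : MvPolynomial (Fin 2) k) = ((i * w 0 + j * w 1 : ℕ) : ℕ∞) := by
  rw [monomialOrd_mul, X_pow_eq_monomial, X_pow_eq_monomial, monomialOrd_monomial w _ one_ne_zero,
    monomialOrd_monomial w _ one_ne_zero, Finsupp.weight_single, Finsupp.weight_single, smul_eq_mul, smul_eq_mul,
    Nat.cast_add]

/-- `ν_w(−F) = ν_w(F)` (plumbing). [cite: AbramovichTemkinWlodarczyk2024, Rem. 5.2.3] -/
private theorem monomialOrd_neg₁₉ {σ : Type*} (w : σ → ℕ) (F : MvPolynomial σ k) :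
    monomialOrd w (-F) = monomialOrd w F := by
  rw [show -F = C (-1 : k) * F by rw [C_neg, C_1, neg_one_mul]]
  exact monomialOrd_mul_of_constantCoeff_ne_zero w (by rw [constantCoeff_C]; exact neg_ne_zero.2 one_ne_zero) F

/-- `n ≤ ν(A)`, `n ≤ ν(B)` ⟹ `n ≤ ν(A + B)` (plumbing). [cite: AbramovichTemkinWlodarczyk2024, Lemma 5.2.6] -/
private theorem le_monomialOrd_add₁₉ {σ : Type*} (w : σ → ℕ) {A B : MvPolynomial σ k} {n : ℕ∞}
    (hA : n ≤ monomialOrd w A) (hB : n ≤ monomialOrd w B) : n ≤ monomialOrd w (A + B) :=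
  le_trans (le_min hA hB) (min_monomialOrd_le_add w A B)

/-- `n ≤ ν(A)`, `n ≤ ν(B)` ⟹ `n ≤ ν(A − B)` (plumbing). [cite: AbramovichTemkinWlodarczyk2024, Lemma 5.2.6] -/
private theorem le_monomialOrd_sub₁₉ {σ : Type*} (w : σ → ℕ) {A B : MvPolynomial σ k} {n : ℕ∞}
    (hA : n ≤ monomialOrd w A) (hB : n ≤ monomialOrd w B) : n ≤ monomialOrd w (A - B) := by
  rw [sub_eq_add_neg]
  exact le_monomialOrd_add₁₉ w hA (by rwa [monomialOrd_neg₁₉])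

/-- Coefficients of `x^i y^j` (plumbing). [folklore] -/
private theorem coeff_X_pow_mul_X_pow₁₉ (i j : ℕ) (d : Fin 2 →₀ ℕ) :
    coeff d (X 0 ^ i * X 1 ^ j : MvPolynomial (Fin 2) k) =
      if Finsupp.single (0 : Fin 2) i + Finsupp.single 1 j = d then 1 else 0 := by
  classical
  rw [X_pow_eq_monomial, X_pow_eq_monomial, monomial_mul, mul_one, coeff_monomial]

/-- The support of `x^i y^j` (plumbing). [folklore] -/
private theorem support_X_pow_mul_X_pow₁₉ (i j : ℕ) :
    (X 0 ^ i * X 1 ^ j : MvPolynomial (Fin 2) k).support ⊆ {Finsupp.single (0 : Fin 2) i + Finsupp.single 1 j} := by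
  classical
  rw [X_pow_eq_monomial, X_pow_eq_monomial, monomial_mul, mul_one]
  exact support_monomial_subset

/-- The exponent `(i, j)` evaluated (plumbing). [folklore] -/
private theorem e_apply_zero₁₉ (i j : ℕ) : (Finsupp.single (0 : Fin 2) i + Finsupp.single 1 j : Fin 2 →₀ ℕ) 0 = i := by
  simp

/-- The exponent `(i, j)` evaluated (plumbing). [folklore] -/
private theorem e_apply_one₁₉ (i j : ℕ) : (Finsupp.single (0 : Fin 2) i + Finsupp.single 1 j : Fin 2 →₀ ℕ) 1 = j := by
  simp

/-- The total degree of the exponent `(i, j)` (plumbing). [folklore] -/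
private theorem degree_e₁₉ (i j : ℕ) : (Finsupp.single (0 : Fin 2) i + Finsupp.single 1 j : Fin 2 →₀ ℕ).degree = i + j := by
  rw [map_add, Finsupp.degree_single, Finsupp.degree_single]

/-- Exponents `(i, j)` are determined by `i` and `j` (plumbing). [folklore] -/
private theorem e_eq_e_iff₁₉ {i j i' j' : ℕ} :
    (Finsupp.single (0 : Fin 2) i + Finsupp.single 1 j : Fin 2 →₀ ℕ) = Finsupp.single 0 i' + Finsupp.single 1 j' ↔
      i = i' ∧ j = j' := by
  constructor
  · intro h
    have h0 := DFunLike.congr_fun h 0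
    have h1 := DFunLike.congr_fun h 1
    rw [e_apply_zero₁₉, e_apply_zero₁₉] at h0
    rw [e_apply_one₁₉, e_apply_one₁₉] at h1
    exact ⟨h0, h1⟩
  · rintro ⟨rfl, rfl⟩
    rfl

/-- The head of a sorted list is its minimum (plumbing). [folklore] -/
private theorem le_of_mem_of_pairwise₁₉ {c x : ℚ} {es : List ℚ} (hs : (c :: es).Pairwise (· ≤ ·))
    (hx : x ∈ c :: es) : c ≤ x := by
  rcases List.mem_cons.1 hx with rfl | hx
  · exact le_rfl
  · exact (List.pairwise_cons.1 hs).1 x hx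

/-- An entry of the invariant (plumbing). [folklore] -/
private theorem inv_mem_exps₁₉ {N : ℕ} {γ : Fin N → ℚ} {x : Fin N} (hx : γ x ≠ 0) : (γ x)⁻¹ ∈ exps γ := by
  classical
  unfold exps
  rw [List.mem_insertionSort, List.mem_map]
  exact ⟨x, Finset.mem_toList.2 (Finset.mem_filter.2 ⟨Finset.mem_univ _, hx⟩), rfl⟩

/-- The invariant of the two-weight centre `(1/a on y, 1/b on x)`, `a ≤ b` (plumbing). [folklore] -/
private theorem exps_singleWeights_add₁₉ {a b : ℕ} (ha : 0 < a) (hb : 0 < b) (hab : (a : ℚ) ≤ b) :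
    exps (singleWeights (1 : Fin 2) a + singleWeights (0 : Fin 2) b) = [(a : ℚ), (b : ℚ)] := by
  classical
  have hdisj : ∀ x : Fin 2, singleWeights (1 : Fin 2) a x = 0 ∨ singleWeights (0 : Fin 2) b x = 0 := by
    intro x
    by_cases hx : x = 0
    · subst hx; left; simp [singleWeights]
    · right; simp [singleWeights, hx]
  rw [exps_add_eq hdisj, exps_singleWeights 1 ha, exps_singleWeights 0 hb, List.singleton_append,
    List.insertionSort_cons, List.insertionSort_cons, List.insertionSort_nil, List.orderedInsert_nil,
    List.orderedInsert_cons_of_le _ _ hab]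

/-- The scaled weights of the two-weight centre (plumbing). [folklore] -/
private theorem scaled_singleWeights_add₁₉ (a b : ℕ) (ha : 0 < a) (hb : 0 < b) :
    ∀ i : Fin 2, (((fun i : Fin 2 => if i = 0 then a else b) i : ℕ) : ℚ) =
      ((a * b : ℕ) : ℚ) * (singleWeights (1 : Fin 2) a + singleWeights (0 : Fin 2) b) i := by
  have h10 : (1 : Fin 2) ≠ 0 := by decide
  have h01 : (0 : Fin 2) ≠ 1 := by decide
  have haq : (a : ℚ) ≠ 0 := by exact_mod_cast ha.ne'
  have hbq : (b : ℚ) ≠ 0 := by exact_mod_cast hb.ne'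
  intro i
  fin_cases i
  · simp only [Fin.zero_eta, ↓reduceIte, Pi.add_apply, singleWeights, if_neg h01, zero_add, Nat.cast_mul]
    rw [mul_inv_cancel_right₀ hbq]
  · simp only [Fin.mk_one, if_neg h10, Pi.add_apply, singleWeights, ↓reduceIte, add_zero, Nat.cast_mul]
    rw [mul_comm ((a : ℕ) : ℚ), mul_inv_cancel_right₀ haq]

section CharTwo

variable [CharP k 2]

/-! ## §2 The shear `y ↦ y − x²` and the admissible centre `(2, 5)` -/

/-- **`h = u² + uv³ + v⁴` after `y ↦ y − x²` is `y² + x³y − x⁵`** (`(y − x²)² = y² − x⁴` in characteristic 2).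
(derived here) [cite: CossartJannsenSaito2020, Def. 8.8 / Thm. 8.16 (pp. 119–121) (dissolving the solvable vertex u⁴ of
the δ-face by y ↦ y + λu²)] -/
theorem addPolyShear_symm_ecShape :
    (addPolyShear 1 (X 0 ^ 2)).symm (X 1 ^ 2 + X 0 ^ 3 * X 1 + X 0 ^ 4 : MvPolynomial (Fin 2) k) =
      X 0 ^ 0 * X 1 ^ 2 + X 0 ^ 3 * X 1 ^ 1 - X 0 ^ 5 * X 1 ^ 0 := by
  classical
  have h10 : (1 : Fin 2) ≠ 0 := by decide
  have h01 : (0 : Fin 2) ≠ 1 := by decide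
  haveI : ExpChar (MvPolynomial (Fin 2) k) 2 := ExpChar.prime Nat.prime_two
  have hγ : (1 : Fin 2) ∉ (X 0 ^ 2 : MvPolynomial (Fin 2) k).vars := fun h =>
    h10 (by simpa [vars_X] using vars_pow _ _ h)
  have hsymm1 : (addPolyShear 1 (X 0 ^ 2)).symm (X 1 : MvPolynomial (Fin 2) k) = X 1 - X 0 ^ 2 := by
    rw [addPolyShear_symm_X_self₁₉, killVar_eq_self_of_notMem hγ]
  have hsymm0 : (addPolyShear 1 (X 0 ^ 2)).symm (X 0 : MvPolynomial (Fin 2) k) = X 0 :=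
    addPolyShear_symm_X_of_ne₁₉ 1 _ h01
  rw [map_add, map_add, map_pow, map_mul, map_pow, map_pow, hsymm0, hsymm1, sub_pow_expChar]
  ring

/-- **The centre `(y − x², x; 1/2, 1/5)` is admissible for `u² + uv³ + v⁴`**: in the sheared coordinate the monomials
`y², x³y, x⁵` have weights `1, 11/10, 1`. (derived here) [cite: AbramovichTemkinWlodarczyk2024, Thm. 5.3.1 (2) (p. 1578),
Lemma 5.2.6 (p. 1576)] -/
theorem isCentreFor_ecShape :
    IsCentreFor (X 1 ^ 2 + X 0 ^ 3 * X 1 + X 0 ^ 4 : MvPolynomial (Fin 2) k) (addPolyShear 1 (X 0 ^ 2))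
      (singleWeights (1 : Fin 2) 2 + singleWeights (0 : Fin 2) 5) := by
  classical
  have h10 : (1 : Fin 2) ≠ 0 := by decide
  have hγ0 : constantCoeff (X 0 ^ 2 : MvPolynomial (Fin 2) k) = 0 := by simp [constantCoeff_X]
  refine ⟨constantCoeff_addPolyShear_X 1 hγ0, fun x => ?_, ?_⟩
  · simp only [Pi.add_apply, singleWeights]
    split_ifs <;> positivity
  · rw [addPolyShear_symm_ecShape, isAdmissibleFor_iff_le_monomialOrd _ (fun i : Fin 2 => if i = 0 then 2 else 5)
      (N := 2 * 5) (by norm_num) (scaled_singleWeights_add₁₉ 2 5 two_pos (by norm_num))]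
    refine le_monomialOrd_sub₁₉ _ (le_monomialOrd_add₁₉ _ ?_ ?_) ?_
    all_goals
      rw [monomialOrd_X_pow_mul_X_pow₁₉]
      simp only [↓reduceIte, if_neg h10]
      norm_num

/-- **`(2, 5) ∈ W(u² + uv³ + v⁴)`** in characteristic `2`. (derived here)
[cite: AbramovichTemkinWlodarczyk2024, Thm. 5.3.1 (2) (p. 1578)] -/
theorem ecShape_mem_admissibleInvariants :
    [(2 : ℚ), 5] ∈ admissibleInvariants (X 1 ^ 2 + X 0 ^ 3 * X 1 + X 0 ^ 4 : MvPolynomial (Fin 2) k) := by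
  have h := exps_mem_admissibleInvariants (isCentreFor_ecShape (k := k))
  rw [exps_singleWeights_add₁₉ two_pos (by norm_num) (by norm_num)] at h
  exact_mod_cast h

/-! ## §3 Order, initial form, `δ` and preparedness of the sheared form -/

omit [CharP k 2] in
/-- `ord (u² + uv³ + v⁴) = 2`. (derived here) [cite: AbramovichTemkinWlodarczyk2024, §5.1 (p. 1575) (a₁ = ord)] -/
theorem monomialOrd_ecH :
    monomialOrd (fun _ => 1) (X 1 ^ 2 + X 0 ^ 3 * X 1 + X 0 ^ 4 : MvPolynomial (Fin 2) k) = 2 := by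
  classical
  have hform : (X 1 ^ 2 + X 0 ^ 3 * X 1 + X 0 ^ 4 : MvPolynomial (Fin 2) k) =
      X 0 ^ 0 * X 1 ^ 2 + X 0 ^ 3 * X 1 ^ 1 + X 0 ^ 4 * X 1 ^ 0 := by ring
  rw [hform]
  apply le_antisymm
  · have hne : ∀ i j : ℕ, ¬ (i = 0 ∧ j = 2) →
        ¬ ((Finsupp.single (0 : Fin 2) i + Finsupp.single 1 j : Fin 2 →₀ ℕ) =
            Finsupp.single 0 0 + Finsupp.single 1 2) := fun i j h h' => h (e_eq_e_iff₁₉.1 h')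
    have hmem : (Finsupp.single (0 : Fin 2) 0 + Finsupp.single 1 2 : Fin 2 →₀ ℕ) ∈
        (X 0 ^ 0 * X 1 ^ 2 + X 0 ^ 3 * X 1 ^ 1 + X 0 ^ 4 * X 1 ^ 0 : MvPolynomial (Fin 2) k).support := by
      rw [mem_support_iff]
      simp only [coeff_add, coeff_X_pow_mul_X_pow₁₉, if_true,
        if_neg (hne 3 1 fun h => by obtain ⟨h1, h2⟩ := h; omega),
        if_neg (hne 4 0 fun h => by obtain ⟨h1, h2⟩ := h; omega)]
      norm_num
    refine (monomialOrd_le_weight (fun _ => 1) hmem).trans (le_of_eq ?_)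
    rw [← Finsupp.degree_eq_weight_one, degree_e₁₉]
    rfl
  · refine le_monomialOrd_add₁₉ _ (le_monomialOrd_add₁₉ _ ?_ ?_) ?_ <;>
      rw [monomialOrd_X_pow_mul_X_pow₁₉, mul_one, mul_one] <;> exact_mod_cast by norm_num

/-- **`ord (y² + x³y − x⁵) = 2`** (order is unchanged by the origin-fixing shear). (derived here)
[cite: AbramovichTemkinWlodarczyk2024, Lemma 5.2.10 (p. 1577)] -/
theorem monomialOrd_ecShape :
    monomialOrd (fun _ => 1) (X 0 ^ 0 * X 1 ^ 2 + X 0 ^ 3 * X 1 ^ 1 - X 0 ^ 5 * X 1 ^ 0 : MvPolynomial (Fin 2) k) = 2 := by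
  rw [← addPolyShear_symm_ecShape, monomialOrd_one_symm_eq _ (isCentreFor_ecShape (k := k)).1, monomialOrd_ecH]

omit [CharP k 2] in
/-- **`in_2(y² + x³y − x⁵) = y²`**. (derived here) [cite: CossartJannsenSaito2020, Def. 8.2 (1) (pp. 117–118)] -/
theorem homogeneousComponent_ecShape :
    homogeneousComponent 2 (X 0 ^ 0 * X 1 ^ 2 + X 0 ^ 3 * X 1 ^ 1 - X 0 ^ 5 * X 1 ^ 0 : MvPolynomial (Fin 2) k) =
      X 1 ^ 2 := by
  classical
  have hc : ∀ i j : ℕ, homogeneousComponent 2 (X 0 ^ i * X 1 ^ j : MvPolynomial (Fin 2) k) =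
      if 2 = i + j then X 0 ^ i * X 1 ^ j else 0 := fun i j =>
    homogeneousComponent_of_mem ((isHomogeneous_X_pow (0 : Fin 2) i).mul (isHomogeneous_X_pow 1 j))
  simp only [map_add, map_sub, hc]
  rw [if_pos trivial, if_neg (by norm_num), if_neg (by norm_num)]
  simp

omit [CharP k 2] in
/-- `in_2 = y²` involves only `y` (hypothesis `hFS` of the vertex theorem, `S = {y}`). (derived here)
[cite: CossartJannsenSaito2020, Setup A / Def. 7.1 (p. 121)] -/
theorem hFS_ecShape :
    ∀ d ∈ (homogeneousComponent 2
      (X 0 ^ 0 * X 1 ^ 2 + X 0 ^ 3 * X 1 ^ 1 - X 0 ^ 5 * X 1 ^ 0 : MvPolynomial (Fin 2) k)).support,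
      ∀ j ∉ ({1} : Finset (Fin 2)), d j = 0 := by
  classical
  intro d hd j hj
  rw [homogeneousComponent_ecShape, X_pow_eq_monomial] at hd
  have := Finset.mem_singleton.1 (support_monomial_subset hd)
  subst this
  exact Finsupp.single_eq_of_ne (fun h => hj (Finset.mem_singleton.2 h))

omit [CharP k 2] in
/-- **`τ = 1`** for the sheared form. (derived here) [cite: CossartJannsenSaito2020, Def. 1.26 / Lemma 1.27 (pp. 22–23)] -/
theorem hironakaTau_ecShape :
    hironakaTau k {homogeneousComponent 2
      (X 0 ^ 0 * X 1 ^ 2 + X 0 ^ 3 * X 1 ^ 1 - X 0 ^ 5 * X 1 ^ 0 : MvPolynomial (Fin 2) k)} = 1 := by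
  rw [homogeneousComponent_ecShape, hironakaTau_X_pow 1 two_ne_zero]

omit [CharP k 2] in
/-- The three exponents of the sheared form. (plumbing) [folklore] -/
private theorem mem_support_ecShape {d : Fin 2 →₀ ℕ}
    (hd : d ∈ (X 0 ^ 0 * X 1 ^ 2 + X 0 ^ 3 * X 1 ^ 1 - X 0 ^ 5 * X 1 ^ 0 : MvPolynomial (Fin 2) k).support) :
    d = Finsupp.single 0 0 + Finsupp.single 1 2 ∨ d = Finsupp.single 0 3 + Finsupp.single 1 1 ∨
      d = Finsupp.single 0 5 + Finsupp.single 1 0 := by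
  classical
  have h1 : ∀ {i j : ℕ} {d : Fin 2 →₀ ℕ}, d ∈ (X 0 ^ i * X 1 ^ j : MvPolynomial (Fin 2) k).support →
      d = Finsupp.single 0 i + Finsupp.single 1 j := fun hd =>
    Finset.mem_singleton.1 (support_X_pow_mul_X_pow₁₉ _ _ hd)
  rcases Finset.mem_union.1 (support_sub _ _ _ hd) with hd | hd
  · rcases Finset.mem_union.1 (support_add hd) with hd | hd
    · exact Or.inl (h1 hd)
    · exact Or.inr (Or.inl (h1 hd))
  · exact Or.inr (Or.inr (h1 hd))

omit [CharP k 2] in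
/-- The vertex `x⁵` is a monomial of the sheared form. (plumbing) [folklore] -/
private theorem vertex_mem_support_ecShape :
    Finsupp.single 0 5 + Finsupp.single 1 0 ∈
      (X 0 ^ 0 * X 1 ^ 2 + X 0 ^ 3 * X 1 ^ 1 - X 0 ^ 5 * X 1 ^ 0 : MvPolynomial (Fin 2) k).support := by
  classical
  have hne : ∀ i j : ℕ, ¬ (i = 5 ∧ j = 0) →
      ¬ ((Finsupp.single (0 : Fin 2) i + Finsupp.single 1 j : Fin 2 →₀ ℕ) =
          Finsupp.single 0 5 + Finsupp.single 1 0) := fun i j h h' => h (e_eq_e_iff₁₉.1 h')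
  rw [mem_support_iff]
  simp only [coeff_add, coeff_sub, coeff_X_pow_mul_X_pow₁₉, if_true,
    if_neg (hne 0 2 fun h => by obtain ⟨h1, h2⟩ := h; omega),
    if_neg (hne 3 1 fun h => by obtain ⟨h1, h2⟩ := h; omega)]
  norm_num

omit [CharP k 2] in
/-- **`δ(y² + x³y − x⁵; x; y) = 5/2`**: the vertices of `Δ` are `x³y ↦ 3/(2−1) = 3` and `x⁵ ↦ 5/2`; the minimum
is attained only at `x⁵`. (derived here) [cite: CossartJannsenSaito2020, Def. 8.1 (3) / Def. 8.2 (1) (pp. 117–118)] -/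
theorem hironakaDelta_ecShape :
    hironakaDelta ({1} : Finset (Fin 2)) 2
      (X 0 ^ 0 * X 1 ^ 2 + X 0 ^ 3 * X 1 ^ 1 - X 0 ^ 5 * X 1 ^ 0 : MvPolynomial (Fin 2) k) =
      ((((5 : ℕ) : ℚ) / ((2 : ℕ) : ℚ) : ℚ) : WithTop ℚ) := by
  classical
  apply le_antisymm
  · unfold hironakaDelta
    refine (Finset.inf_le (Finset.mem_filter.2 ⟨vertex_mem_support_ecShape (k := k), ?_⟩)).trans (le_of_eq ?_)
    · rw [blockDeg_singleton, e_apply_one₁₉]; exact two_pos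
    · rw [coDeg_singleton, blockDeg_singleton, degree_e₁₉, e_apply_one₁₉]
  · rw [le_hironakaDelta_iff]
    intro d hd hb
    rw [blockDeg_singleton] at hb
    rw [coDeg_singleton, blockDeg_singleton]
    rcases mem_support_ecShape (k := k) hd with rfl | rfl | rfl <;>
      rw [e_apply_one₁₉] at hb ⊢ <;> (try omega) <;> (simp only [degree_e₁₉]; norm_num)

omit [CharP k 2] in
/-- **The sheared form is `δ`-prepared** (vacuously: `δ = 5/2` is not an integer, so no lattice vertex lies on the
`δ`-face). (derived here) [cite: CossartJannsenSaito2020, Def. 8.8 / Thm. 8.16 (pp. 119–121)] -/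
theorem isDeltaPrepared_ecShape :
    IsDeltaPrepared ({1} : Finset (Fin 2)) 2
      (X 0 ^ 0 * X 1 ^ 2 + X 0 ^ 3 * X 1 ^ 1 - X 0 ^ 5 * X 1 ^ 0 : MvPolynomial (Fin 2) k) := by
  intro v _ hdeg
  exfalso
  rw [hironakaDelta_ecShape, WithTop.coe_eq_coe] at hdeg
  have h : ((v.degree * 2 : ℕ) : ℚ) = ((5 : ℕ) : ℚ) := by
    rw [Nat.cast_mul, hdeg, div_mul_cancel₀ _ (by norm_num)]
  have h' : v.degree * 2 = 5 := by exact_mod_cast h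
  omega

/-! ## §4 Maximality: `max W(u² + uv³ + v⁴) = (2, 5)` -/

/-- `W(y² + x³y − x⁵) = W(u² + uv³ + v⁴)` (origin-fixing coordinate change). (derived here)
[cite: AbramovichTemkinWlodarczyk2024, Thm. 1.1.1 (3) (p. 1562) (functoriality)] -/
theorem admissibleInvariants_ecShape :
    admissibleInvariants (X 0 ^ 0 * X 1 ^ 2 + X 0 ^ 3 * X 1 ^ 1 - X 0 ^ 5 * X 1 ^ 0 : MvPolynomial (Fin 2) k) =
      admissibleInvariants (X 1 ^ 2 + X 0 ^ 3 * X 1 + X 0 ^ 4 : MvPolynomial (Fin 2) k) := by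
  rw [← addPolyShear_symm_ecShape]
  exact admissibleInvariants_map_eq _ (constantCoeff_symm_X_eq_zero_of_forall _ (isCentreFor_ecShape (k := k)).1) _

/-- **Upper bound: no invariant of `u² + uv³ + v⁴` exceeds `(2, 5)`** (characteristic `2`).  In the sheared
coordinates: a centre with a weight `> 1/2` has leading entry `< 2`; otherwise the vertex theorem for the
`δ`-prepared form (`τ = 1`, `δ = 5/2`) gives two weights `≥ 1/5`, i.e. `b₁ = 2`, `b₂ ≤ 5`. (derived here)
[cite: CossartJannsenSaito2020, Thm. 8.16 (p. 121)] [cite: AbramovichTemkinWlodarczyk2024, Thm. 5.1.1 / §5.3 (pp. 1575–1578)] -/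
theorem not_lt_of_mem_admissibleInvariants_ecShape {c : List ℚ}
    (hc : c ∈ admissibleInvariants (X 1 ^ 2 + X 0 ^ 3 * X 1 + X 0 ^ 4 : MvPolynomial (Fin 2) k)) :
    ¬ ATW.TruncLex.lt [(2 : ℚ), 5] c := by
  classical
  rw [← admissibleInvariants_ecShape] at hc
  obtain ⟨Ψ, γ, h, rfl⟩ := hc
  have he0 : (0 : ℚ) < (2 : ℕ) := by norm_num
  have hord := monomialOrd_ecShape (k := k)
  have hτ : ({1} : Finset (Fin 2)).card = hironakaTau k {homogeneousComponent 2
      (X 0 ^ 0 * X 1 ^ 2 + X 0 ^ 3 * X 1 ^ 1 - X 0 ^ 5 * X 1 ^ 0 : MvPolynomial (Fin 2) k)} := by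
    rw [hironakaTau_ecShape, Finset.card_singleton]
  have hs := exps_sorted γ
  by_cases hall : ∀ x, γ x ≤ ((2 : ℕ) : ℚ)⁻¹
  · obtain ⟨es, hes⟩ : ∃ es, exps γ = ((2 : ℕ) : ℚ) :: es := by
      obtain ⟨t, ht⟩ := replicate_prefix_of_forall_le hord h hall
      rw [hironakaTau_ecShape, List.replicate_one] at ht
      exact ⟨t, ht.symm⟩
    have hcount := succ_card_le_countP_exps_of_isDeltaPrepared hord hτ (hFS_ecShape (k := k))
      (isDeltaPrepared_ecShape (k := k)) (hironakaDelta_ecShape (k := k)) h hall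
    rw [Finset.card_singleton, hes] at hcount
    have heδ : ((2 : ℕ) : ℚ) * (((5 : ℕ) : ℚ) / ((2 : ℕ) : ℚ)) = 5 := by norm_num
    rw [heδ] at hcount
    rw [hes]
    cases es with
    | nil =>
      exfalso
      rw [List.countP_cons, List.countP_nil] at hcount
      split_ifs at hcount <;> omega
    | cons e₂ es' =>
      have hs₂ : (e₂ :: es').Pairwise (· ≤ ·) := by
        have := hs
        rw [hes] at this
        exact (List.pairwise_cons.1 this).2
      have hex : ∃ x ∈ e₂ :: es', x ≤ (5 : ℚ) := by
        by_contra hne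
        push Not at hne
        have h0 : (e₂ :: es').countP (fun x => decide (x ≤ (5 : ℚ))) = 0 := by
          rw [List.countP_eq_zero]
          intro x hx
          simpa using hne x hx
        rw [List.countP_cons, h0] at hcount
        split_ifs at hcount <;> omega
      obtain ⟨x, hx, hxF⟩ := hex
      have he₂ : e₂ ≤ (5 : ℚ) := (le_of_mem_of_pairwise₁₉ hs₂ hx).trans hxF
      intro hlt
      rw [ATW.TruncLex.cons_lt_cons] at hlt
      rcases hlt with hlt | ⟨-, hlt⟩
      · exact lt_irrefl _ (by exact_mod_cast hlt)
      · rw [ATW.TruncLex.cons_lt_cons] at hlt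
        rcases hlt with hlt | ⟨hEq, hlt⟩
        · exact not_lt.2 he₂ hlt
        · exact ATW.TruncLex.not_nil_lt _ hlt
  · push Not at hall
    obtain ⟨x, hx⟩ := hall
    have hγx : 0 < γ x := (inv_pos.2 he0).trans hx
    have hinv : (γ x)⁻¹ < ((2 : ℕ) : ℚ) := by
      have := inv_strictAnti₀ (inv_pos.2 he0) hx
      rwa [inv_inv] at this
    have hmem : (γ x)⁻¹ ∈ exps γ := inv_mem_exps₁₉ hγx.ne'
    intro hlt
    cases hγ : exps γ with
    | nil => rw [hγ] at hmem; simp at hmem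
    | cons c₁ cs =>
      rw [hγ] at hmem hlt hs
      have hc₁ : c₁ < 2 := by
        have := (le_of_mem_of_pairwise₁₉ hs hmem).trans_lt hinv
        exact_mod_cast this
      rw [ATW.TruncLex.cons_lt_cons] at hlt
      rcases hlt with hlt | ⟨hEq, -⟩
      · exact lt_asymm hlt hc₁
      · exact hc₁.ne' hEq

/-- **`max W(u² + uv³ + v⁴) = (2, 5)` in characteristic `2`** (`u = X 1`, `v = X 0`), over all admissible centres
after all polynomial coordinate changes. (derived here) [cite: CossartJannsenSaito2020, Thm. 8.16 (p. 121)]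
[cite: AbramovichTemkinWlodarczyk2024, Thm. 5.3.1 (2)–(3) (p. 1578)] -/
theorem isMaxInv_ecShape :
    IsMaxInv (admissibleInvariants (X 1 ^ 2 + X 0 ^ 3 * X 1 + X 0 ^ 4 : MvPolynomial (Fin 2) k)) [(2 : ℚ), 5] :=
  ⟨ecShape_mem_admissibleInvariants, fun _ hc => not_lt_of_mem_admissibleInvariants_ecShape hc⟩

/-! ## §5 Subtracting the fourth power `v⁴` improves the invariant -/

omit [CharP k 2] in
/-- **`(2, 6) ∈ W(u² + uv³) = W(h − v⁴)`**: the centre `(u, v; 1/2, 1/6)` (no coordinate change) is admissible for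
`h − v⁴ = y² + x³y` (weights `1, 1`). (derived here) [cite: AbramovichTemkinWlodarczyk2024, Thm. 5.3.1 (2) (p. 1578)]
[cite: HauserPerlega2019, §2 (subtracting p^e-th powers: cleaning)] -/
theorem ecShape_sub_pow_mem_admissibleInvariants :
    [(2 : ℚ), 6] ∈ admissibleInvariants
      (X 1 ^ 2 + X 0 ^ 3 * X 1 + X 0 ^ 4 - X 0 ^ 4 : MvPolynomial (Fin 2) k) := by
  classical
  have h10 : (1 : Fin 2) ≠ 0 := by decide
  have hc : IsCentreFor (X 1 ^ 2 + X 0 ^ 3 * X 1 + X 0 ^ 4 - X 0 ^ 4 : MvPolynomial (Fin 2) k) AlgEquiv.refl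
      (singleWeights (1 : Fin 2) 2 + singleWeights (0 : Fin 2) 6) := by
    refine ⟨fun x => constantCoeff_X k x, fun x => ?_, ?_⟩
    · simp only [Pi.add_apply, singleWeights]
      split_ifs <;> positivity
    · change IsAdmissibleFor _ (X 1 ^ 2 + X 0 ^ 3 * X 1 + X 0 ^ 4 - X 0 ^ 4 : MvPolynomial (Fin 2) k)
      rw [show (X 1 ^ 2 + X 0 ^ 3 * X 1 + X 0 ^ 4 - X 0 ^ 4 : MvPolynomial (Fin 2) k) =
          X 0 ^ 0 * X 1 ^ 2 + X 0 ^ 3 * X 1 ^ 1 by ring,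
        isAdmissibleFor_iff_le_monomialOrd _ (fun i : Fin 2 => if i = 0 then 2 else 6) (N := 2 * 6) (by norm_num)
          (scaled_singleWeights_add₁₉ 2 6 two_pos (by norm_num))]
      refine le_monomialOrd_add₁₉ _ ?_ ?_
      all_goals
        rw [monomialOrd_X_pow_mul_X_pow₁₉]
        simp only [↓reduceIte, if_neg h10]
        norm_num
  have h := exps_mem_admissibleInvariants hc
  rw [exps_singleWeights_add₁₉ two_pos (by norm_num) (by norm_num)] at h
  exact_mod_cast h

/-- **The observatory's law C146 is false** (`p = 2`, `q = 4`, `h = u² + uv³ + v⁴`): `max W(h) = (2, 5)` — no entry has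
numerator divisible by `4` — and yet subtracting the `4`-th power `v⁴` improves the invariant: `(2, 6) ∈ W(h − v⁴)` with
`(2, 5) < (2, 6)`.  So `C_4(h) := max_G W(h − G⁴) ≠ W(h)` without any entry of `max W(h)` having numerator divisible
by `q`. (derived here; the observatory's engine found the example numerically)
[cite: HauserPerlega2019, §2 (cleaning / residual order)] [cite: Hauser2010, §C–§D (pp. 9–12)]
[cite: CossartJannsenSaito2020, Thm. 8.16 (p. 121)] -/
theorem ecShape_counterexample :
    IsMaxInv (admissibleInvariants (X 1 ^ 2 + X 0 ^ 3 * X 1 + X 0 ^ 4 : MvPolynomial (Fin 2) k)) [(2 : ℚ), 5] ∧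
      [(2 : ℚ), 6] ∈ admissibleInvariants (X 1 ^ 2 + X 0 ^ 3 * X 1 + X 0 ^ 4 - X 0 ^ 4 : MvPolynomial (Fin 2) k) ∧
      ATW.TruncLex.lt [(2 : ℚ), 5] [(2 : ℚ), 6] ∧ ¬ (4 ∣ 2) ∧ ¬ (4 ∣ 5) := by
  refine ⟨isMaxInv_ecShape, ecShape_sub_pow_mem_admissibleInvariants, ?_, by decide, by decide⟩
  rw [ATW.TruncLex.cons_lt_cons, ATW.TruncLex.cons_lt_cons]
  right
  exact ⟨rfl, Or.inl (by norm_num)⟩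

end CharTwo

end WeightedBlowup

end Literature.AlgebraicGeometry.Resolution
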